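import Summits.HodgeConjecture.HodgeConjecture.Theorems.H413E2SWSplitPlaceFrameTorus
import HarnessLib

/-!
# H413 · E-2 · SW2 (iii) — the ONE-PLACE TORUS IDELE of the `W□`-member (letter `hLD`, atom (ζ) of the (S-1) glue)

Cell `hodgecm-mathlib`, crux H413 (`stmt-HodgeConjecture-24833`), child line `Cruxes/H413/Lines/F0_E2SiegelWeilWeilRange.lean`,
`StubSW2` (iii), I-CLOSE step (S-1) (`Theorems/H413E2SWDilateBoundCM :: hbd_CM`, binder `hLD`; glue `hbd_CM_of_letters`); sibling of
★ `Theorems/H413E2SWSplitPlaceFrameTorus` (p811655).  PROOF lane, `--supports stmt-HodgeConjecture-24833 --as helper`.  KERNEL MATHEMATICS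
ONLY (one theorem; no definition, no `sorry`).  HC_CM is proved only modulo the 7 printed citations until rung 0 closes.

THE MATHEMATICS (Weil (1965) Chap. V n° 50 p. 74; Cassels–Fröhlich Ch. II §14).  Let `v` be a finite place of `F` split in the CM extension
`E = F(δ)`, `δ² = d`, `s ∈ F_v` with `s² = d`, and `r ∈ F_vˣ`.  Put `a := (r+1)/2`, `b := (r−1)/(2s)` (so `a + s b = r`, `a − s b = 1`),
`p₂ := 1 − ι_v(1) + ι_v(a)`, `q₂ := ι_v(b)` (`ι_v : F_v → 𝔸_F` the factor inclusion) and `V := p₂ ⊗ 1 + (q₂ ⊗ 1) δ ∈ 𝔸_E`.  Then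
`N(V) = p₂² − d q₂² = 1 − ι_v(1) + ι_v(r)` is the one-place idele of `r` (inverse `1 − ι_v(1) + ι_v(r⁻¹)`), so `V` is an idele and
`t := V̄ = p₂ ⊗ 1 − (q₂ ⊗ 1) δ` is THE ONE-PLACE TORUS IDELE: `c̄ t = V` has real and imaginary parts `p₂`, `q₂` (A-p16's `hp₂ hq₂` of
★ `exists_lift_torus`), these are local at `v` with `v`-components `a`, `b` (★ `fr_vecMul_torus`: through the split-place frame `t` dilates the
`x`-half by `r` and fixes the rest), and `(p₂', q₂') := (p₂, −q₂) · N(V)⁻¹` satisfy `p₂ p₂' + d q₂ q₂' = 1`, `p₂ q₂' + q₂ p₂' = 0` (B-p04's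
`exists_torusTwistGL` inputs).  In Weil's words (n° 50): at the auxiliary place the torus of `U(1)` is `F_v^× × F_v^×` and one takes the element
`(r, 1)`.

References: A. Weil, *Sur la formule de Siegel dans la théorie des groupes classiques*, Acta Math. 113 (1965), Chap. V n° 50 p. 74
[cite: Weil1965, Chap. V n° 50, pp. 73–74]; J. W. S. Cassels, A. Fröhlich (eds.), *Algebraic Number Theory* (1967), Ch. II §14
[cite: CasselsFrohlichANT1967, Ch. II §14].
-/

set_option autoImplicit false
-- the cell's `Summit.HodgeConjecture.HodgeConjecture.…` namespace repeats the summit name by design (D-0017 layout)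
set_option linter.dupNamespace false

noncomputable section

namespace Summit.HodgeConjecture.HodgeConjecture.Cruxes.H413.E2SWSplitPlaceFrame

open scoped Matrix
open NumberField IsDedekindDomain
open Literature.NumberTheory.Automorphic Literature.NumberTheory.Automorphic.UnitaryGroup

variable (F E : Type) [Field F] [NumberField F] [Field E] [NumberField E] [Algebra F E] [Algebra.IsQuadraticExtension F E]
  (c : E ≃ₐ[F] E) {δ : E} (hcδ : c δ = -δ) (hδ : δ ≠ 0) {d : F} (hd : δ * δ = algebraMap F E d)
  (v : HeightOneSpectrum (𝓞 F))

omit [Algebra.IsQuadraticExtension F E] in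
/-- a principal adele read at `v` (definitional). [folklore] -/
private theorem adeleEval_algebraMap'' (x : F) :
    AdelicGroupData.adeleEval F v (algebraMap F (AdeleRing (𝓞 F) F) x) = algebraMap F (v.adicCompletion F) x := rfl

include hd in
/-- **THE ONE-PLACE TORUS IDELE.**  For `s² = d` in `F_v` and `r ≠ 0` in `F_v` there are an idele `t ∈ 𝔸_E^×`, adeles `p₂ q₂ ∈ 𝔸_F` and
`a b ∈ F_v` with: `re (c̄ t) = p₂`, `im (c̄ t) = q₂` (coordinates of ★ `quadraticAdeleEquiv`, conjugation ★ `conjAdele` — the `hp₂ hq₂` of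
★ `exists_lift_torus`); `(p₂)_v = a`, `(q₂)_v = b`, `a + s b = r`, `a − s b = 1`; `p₂`, `q₂` local at `v` (`p₂ z = z`, `q₂ z = 0` when `z_v = 0` —
the hypotheses of ★ `fr_vecMul_torus` ∕ `twistLM_torus_apply`); the norm `p₂² − d q₂² = 1 − ι_v(1) + ι_v(r)` (the determinant idele of the
torus matrix is its `n`-th power); and `p₂' q₂'` with `p₂ p₂' + d q₂ q₂' = 1`, `p₂ q₂' + q₂ p₂' = 0` (inputs of the `GL` builder of the torus
matrix). [cite: Weil1965, Chap. V n° 50, pp. 73–74] -/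
theorem exists_onePlaceTorusIdele {s : v.adicCompletion F} (hs : s * s = algebraMap F (v.adicCompletion F) d)
    (r : v.adicCompletion F) (hr : r ≠ 0) :
    ∃ (t : (AdeleRing (𝓞 E) E)ˣ) (p₂ q₂ : AdeleRing (𝓞 F) F) (a b : v.adicCompletion F),
      QuadraticCoordinates.re (quadraticAdeleEquiv F E c hcδ hδ).toAddEquiv
          (UnitaryGroup.conjAdele F E c (t : AdeleRing (𝓞 E) E)) = p₂ ∧
      QuadraticCoordinates.im (quadraticAdeleEquiv F E c hcδ hδ).toAddEquiv
          (UnitaryGroup.conjAdele F E c (t : AdeleRing (𝓞 E) E)) = q₂ ∧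
      AdelicGroupData.adeleEval F v p₂ = a ∧ AdelicGroupData.adeleEval F v q₂ = b ∧
      a + s * b = r ∧ a - s * b = 1 ∧
      (∀ z : AdeleRing (𝓞 F) F, AdelicGroupData.adeleEval F v z = 0 → p₂ * z = z) ∧
      (∀ z : AdeleRing (𝓞 F) F, AdelicGroupData.adeleEval F v z = 0 → q₂ * z = 0) ∧
      p₂ * p₂ - algebraMap F (AdeleRing (𝓞 F) F) d * (q₂ * q₂) = 1 - adeleSingleHom F v 1 + adeleSingleHom F v r ∧
      (∃ p₂' q₂' : AdeleRing (𝓞 F) F,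
        p₂ * p₂' + algebraMap F (AdeleRing (𝓞 F) F) d * (q₂ * q₂') = 1 ∧ p₂ * q₂' + q₂ * p₂' = 0) := by
  -- `2 ≠ 0` and `s ≠ 0` in `F_v`
  have h2 : (2 : v.adicCompletion F) ≠ 0 := by
    rw [show (2 : v.adicCompletion F) = algebraMap F (v.adicCompletion F) 2 from (map_ofNat _ 2).symm]
    exact (map_ne_zero_iff _ (algebraMap F (v.adicCompletion F)).injective).mpr two_ne_zero
  have hs0 : s ≠ 0 := by
    rintro rfl
    rw [zero_mul] at hs
    have hd0 : d = 0 := (map_eq_zero_iff _ (algebraMap F (v.adicCompletion F)).injective).mp hs.symm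
    apply hδ
    rw [hd0, map_zero] at hd
    exact mul_self_eq_zero.mp hd
  -- the local scalars
  set a : v.adicCompletion F := (r + 1) / 2 with ha
  set b : v.adicCompletion F := (r - 1) / (2 * s) with hb
  have hab1 : a + s * b = r := by
    rw [ha, hb]; field_simp; ring
  have hab2 : a - s * b = 1 := by
    rw [ha, hb]; field_simp; ring
  -- the factor inclusion `ι = ι_v` and its algebra
  set ι := adeleSingleHom F v with hι
  have hιι : ∀ x y : v.adicCompletion F, ι x * ι y = ι (x * y) := fun x y => (map_mul ι x y).symm
  have hι1 : ∀ x, (1 - ι 1) * ι x = 0 := fun x => by rw [sub_mul, one_mul, hιι, one_mul, sub_self]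
  have hu : (1 - ι 1) * (1 - ι 1) = 1 - ι 1 := by rw [mul_sub, mul_one, hι1, sub_zero]
  set p₂ : AdeleRing (𝓞 F) F := 1 - ι 1 + ι a with hp
  set q₂ : AdeleRing (𝓞 F) F := ι b with hq
  set dA : AdeleRing (𝓞 F) F := algebraMap F (AdeleRing (𝓞 F) F) d with hdA
  -- the norm `ν = p₂² − d q₂² = 1 − ι 1 + ι r` and its inverse
  have hν : p₂ * p₂ - dA * (q₂ * q₂) = 1 - ι 1 + ι r := by
    have e1 : p₂ * p₂ = (1 - ι 1) + ι (a * a) := by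
      rw [hp, add_mul, mul_add, mul_add, hu, hι1, mul_comm (ι a) (1 - ι 1), hι1, hιι, add_zero, zero_add]
    have e2 : dA * (q₂ * q₂) = ι (algebraMap F (v.adicCompletion F) d * (b * b)) := by
      rw [hq, hιι, mul_comm dA, hι, adeleSingleHom_mul F v (b * b) dA, hdA, adeleEval_algebraMap'', mul_comm]
    have e3 : a * a - algebraMap F (v.adicCompletion F) d * (b * b) = r := by
      rw [← hs, show a * a - s * s * (b * b) = (a + s * b) * (a - s * b) by ring, hab1, hab2, mul_one]
    rw [e1, e2, add_sub_assoc, ← map_sub, e3]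
  have hνν : (1 - ι 1 + ι r) * (1 - ι 1 + ι r⁻¹) = 1 := by
    rw [add_mul, mul_add, mul_add, hu, hι1, mul_comm (ι r) (1 - ι 1), hι1, hιι, mul_inv_cancel₀ hr, add_zero, zero_add,
      sub_add_cancel]
  -- the quadratic coordinates of `𝔸_E`
  have hQ := isQuadraticCoordinates_adele E c hcδ hδ hd
  set φ := AdeleRing.baseChange F E with hφ
  set δA := algebraMap E (AdeleRing (𝓞 E) E) δ with hδA
  have hcδA : UnitaryGroup.conjAdele F E c δA = -δA := by
    rw [hδA, ← map_neg, ← hcδ]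
    exact (UnitaryGroup.algebraMap_conj F E c δ).symm
  -- `t = V̄`, `V = φ p₂ + φ q₂ δ`, `t V = φ ν`
  set tval : AdeleRing (𝓞 E) E := φ p₂ + φ (-q₂) * δA with htval
  set V : AdeleRing (𝓞 E) E := φ p₂ + φ q₂ * δA with hV
  have htV : tval * V = φ (p₂ * p₂ - dA * (q₂ * q₂)) := by
    rw [htval, hV, hQ.mul_formula p₂ (-q₂) p₂ q₂, show p₂ * q₂ + -q₂ * p₂ = 0 by ring, map_zero, zero_mul, add_zero,
      show p₂ * p₂ + dA * (-q₂ * q₂) = p₂ * p₂ - dA * (q₂ * q₂) by ring]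
  have hunit : tval * (V * φ (1 - ι 1 + ι r⁻¹)) = 1 := by
    rw [← mul_assoc, htV, ← map_mul, hν, hνν, map_one]
  let t : (AdeleRing (𝓞 E) E)ˣ := Units.mkOfMulEqOne tval _ hunit
  have ht : (t : AdeleRing (𝓞 E) E) = tval := rfl
  have hcφ : ∀ x, UnitaryGroup.conjAdele F E c (φ x) = φ x := fun x => by
    rw [hφ, UnitaryGroup.conjAdele_apply, AdeleRing.smul_baseChange]
  have hconj : UnitaryGroup.conjAdele F E c tval = V := by
    rw [htval, map_add, map_mul, hcφ, hcφ, hcδA, map_neg, neg_mul_neg]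
  refine ⟨t, p₂, q₂, a, b, ?_, ?_, ?_, adeleEval_adeleSingleHom F v b, hab1, hab2, fun z hz => ?_, fun z hz => ?_, hν,
    ⟨p₂ * (1 - ι 1 + ι r⁻¹), -(q₂ * (1 - ι 1 + ι r⁻¹)), ?_, by ring⟩⟩
  · rw [ht, hconj, hV]
    exact hQ.re_eq p₂ q₂
  · rw [ht, hconj, hV]
    exact hQ.im_eq p₂ q₂
  · rw [hp, map_add, map_sub, map_one, hι, adeleEval_adeleSingleHom, adeleEval_adeleSingleHom, sub_self, zero_add]
  · rw [hp, add_mul, sub_mul, one_mul, hι, adeleSingleHom_mul, adeleSingleHom_mul, hz, mul_zero, mul_zero, map_zero, sub_zero,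
      add_zero]
  · rw [hq, hι, adeleSingleHom_mul, hz, mul_zero, map_zero]
  · rw [show p₂ * (p₂ * (1 - ι 1 + ι r⁻¹)) + dA * (q₂ * -(q₂ * (1 - ι 1 + ι r⁻¹))) =
        (p₂ * p₂ - dA * (q₂ * q₂)) * (1 - ι 1 + ι r⁻¹) by ring, hν, hνν]

end Summit.HodgeConjecture.HodgeConjecture.Cruxes.H413.E2SWSplitPlaceFrame
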